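import Mathlib
import Summits.CriticalPhenomena.PercolationContinuityZ3.Theorems.PercNearOneGluingNoHeavyLowerTailDeltaMSTwin

/-!
# Δ-MS, part 2: the projective Marica–Schönheim inequality and the twin lemma

Support file for crux `stmt-CriticalPhenomena-4575` (`NoHeavyLowerTail`, route `PercNearOneGluingNoHeavy`), hull-port seat `prim-hp-7`
(generation 66); `--supports stmt-CriticalPhenomena-4575`.  No `sorry`.  Memo: `run/shared/lean/prim/prim-hp-7/FROM-prim-hp-7-g66-DELTA-MS-PROOF.md`.

**Theorem (Δ-MS, projective Marica–Schönheim; conjectured by g65 as the one-axis case of Δ-HEX, SAT-exact for `n ≤ 6` there; proved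
g66).**  For every family `F` of subsets of a finite ground set `U`, the family of differences `F \\ F = {a \ b}` meets at least as many
complementary pairs `{s, U \ s}` as `F` does: `#(F ∪ co F) ≤ #((F \\ F) ∪ co (F \\ F))` (`card_cl_le_card_cl_diffs`); for a
complement-free `F`, `2 · #F ≤ #((F \\ F) ∪ co (F \\ F))` (`two_mul_card_le_card_cl_diffs`).  Marica–Schönheim
(`Finset.card_le_card_diffs`, `#F ≤ #(F \\ F)`) is the case in which all members avoid a common point; equivalent forms: `(H2)` — for
disjoint `X, Y ⊆ 𝒫[m]`, `#X + #Y ≤ #(X \\ X ∪ Y \\ Y ∪ X ⊼ Y ∪ X ⊻ Y)` — and Δ-HEX of `…HexMSDelta` for at most two adjacent axes.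

It is the case `I = J = ∅` of the **twin lemma** `card_twinIn_le_card_cl_twinOut`: for `C` arbitrary and `I, J` closed under `U \ ·`,
`#((C ∪ co C) ∪ (I ∪ J)) ≤ #(OUT ∪ co OUT)`, `OUT = ((C ∪ J) ⊼ (co C ∪ I)) ∪ (I ∪ J)`, proved by induction on `U`: with the projection
identity `#Z = #(Z.image (erase r)) + #(edgesAt Z r)`, the projected families (part 1) bound the first summand and the derived
configuration `(C₂, I₂, J₂)` (part 1) the second, because its OUT consists of `r`-twins of `OUT ∪ co OUT`
(`twinOut_twin_subset_edgesAt`, the heart of the matter: with `P = C ∪ J`, `N = co C ∪ I`, every relevant `r`-free member lies in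
`P ∪ N` and has its `r`-twin in `P` resp. `N`, so `insert r (p ∩ q) ∈ P ⊼ N`, and `p ∩ q ∈ P ⊼ N` after inserting `r` into the member on
the wrong side).  Consequently g65's one-axis 'edge lemma' holds in EVERY direction, and (iterating) so does the subcube form `(H2-cube)`.
-/

namespace Summit.CriticalPhenomena.PercolationContinuityZ3.Theorems

namespace GeneratedDonors

open Finset FinsetFamily

variable {α : Type*} [DecidableEq α]

section DeltaMS

section Step

variable {U' : Finset α} {r : α} {C I J : Finset (Finset α)}

/-- **The heart of the induction**: every output of the derived configuration is an `r`-twin of the (closed) output.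
Writing `P = C ∪ J`, `N = co C ∪ I` (so the output is `cl (P ⊼ N ∪ I ∪ J)`): a member `w` of `C₂ ∪ J₂` has `insert r w ∈ P`, a member of
`co C₂ ∪ I₂` has `insert r w ∈ N`, and all of them lie in `P ∪ N`; hence `insert r (p ∩ q) = insert r p ∩ insert r q ∈ P ⊼ N`, and
`p ∩ q ∈ P ⊼ N` by inserting `r` into whichever of `p, q` lies on the wrong side. -/
theorem twinOut_twin_subset_edgesAt (hr : r ∉ U')
    (hC : ∀ c ∈ C, c ⊆ insert r U') (hI : ∀ i ∈ I, i ⊆ insert r U') (hJ : ∀ j ∈ J, j ⊆ insert r U')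
    (hIc : ∀ i ∈ I, insert r U' \ i ∈ I) (hJc : ∀ j ∈ J, insert r U' \ j ∈ J) :
    ((((Finset.filter (fun w => r ∉ w ∧ insert r w ∈ C ∪ J) (C ∪ I)) ∪ (Finset.filter (fun w => r ∉ w ∧ insert r w ∈ C ∪ J) (J
          ∪ Finset.image (fun c => (insert r U') \ c) C))) ⊼ (Finset.image (fun c => U' \ c) (Finset.filter (fun w => r ∉ w ∧ insert r w ∈ C ∪ J) (C ∪ I))
          ∪ (Finset.filter (fun w => r ∉ w ∧ insert r w ∈ I ∪ Finset.image (fun c => (insert r U') \ c) C) (C ∪ I)))) ∪ ((Finset.filter (fun w => r ∉ w ∧ insert r w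
          ∈ I ∪ Finset.image (fun c => (insert r U') \ c) C) (C ∪ I)) ∪ (Finset.filter (fun w => r ∉ w ∧ insert r w ∈ C ∪ J) (J ∪ Finset.image (fun c => (insert r U') \ c) C)))) ⊆
      edgesAt (((((C ∪ J) ⊼ (Finset.image (fun c => (insert r U') \ c) C ∪ I)) ∪ (I ∪ J)) ∪ Finset.image (fun z => (insert r U') \ z) (((C
            ∪ J) ⊼ (Finset.image (fun c => (insert r U') \ c) C ∪ I)) ∪ (I ∪ J)))) r := by
  -- abbreviations
  set U : Finset α := insert r U' with hU
  set O := ((((C ∪ J) ⊼ (Finset.image (fun c => U \ c) C ∪ I)) ∪ (I ∪ J)) ∪ Finset.image (fun z => U \ z) (((C ∪ J) ⊼ (Finset.image (fun c => U \ c) C ∪ I)) ∪ (I ∪ J))) with hO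
  have hout : ∀ s ∈ (((C ∪ J) ⊼ (Finset.image (fun c => U \ c) C ∪ I)) ∪ (I ∪ J)), s ⊆ U := twinOut_subset hC hI hJ
  -- `P`-membership and `N`-membership
  have memP : ∀ {p : Finset α}, (p ∈ C ∨ p ∈ J) → ∀ {q : Finset α}, ((∃ c ∈ C, U \ c = q) ∨ q ∈ I) →
      p ∩ q ∈ O := fun {p} hp {q} hq => mem_cl_of_mem (inter_mem_twinOut hp hq)
  -- every r-free member w of H = C ∪ I ∪ J ∪ co C with insert r w ∈ P or ∈ N: the four "sides"
  -- Main case analysis for meets.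
  intro z hz
  rw [mem_edgesAt]
  rcases mem_twinOut.mp hz with ⟨p, hp, q, hq, rfl⟩ | (h | h)
  · -- p ∈ C₂ ∪ J₂, q ∈ co C₂ ∪ I₂
    -- facts about p
    have hp' : r ∉ p ∧ (insert r p ∈ C ∨ insert r p ∈ J) ∧
        ((p ∈ C ∨ p ∈ J) ∨ ((∃ c ∈ C, U \ c = p) ∨ p ∈ I)) := by
      rcases hp with hp | hp
      · obtain ⟨h1, hrp, h2⟩ := mem_twinC.mp hp
        exact ⟨hrp, h2, h1.elim (fun h => Or.inl (Or.inl h)) (fun h => Or.inr (Or.inr h))⟩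
      · obtain ⟨h1, hrp, h2⟩ := mem_twinJ.mp hp
        exact ⟨hrp, h2, h1.elim (fun h => Or.inl (Or.inr h)) (fun h => Or.inr (Or.inl h))⟩
    -- facts about q
    have hq' : r ∉ q ∧ ((∃ c ∈ C, U \ c = insert r q) ∨ insert r q ∈ I) ∧
        ((q ∈ C ∨ q ∈ J) ∨ ((∃ c ∈ C, U \ c = q) ∨ q ∈ I)) := by
      rcases hq with ⟨c₂, hc₂, hcq⟩ | hq
      · obtain ⟨h1, hrc, h2⟩ := mem_twinC.mp hc₂
        have hc₂U : c₂ ⊆ U' := subset_of_subset_insert_of_notMem (h1.elim (hC c₂) (hI c₂)) hrc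
        have hrq : r ∉ q := by rw [← hcq]; exact fun h => hr (mem_sdiff.mp h).1
        refine ⟨hrq, ?_, ?_⟩
        · -- insert r q = U \ c₂ ∈ co C ∪ I
          rw [← hcq, ← Finset.insert_sdiff_of_notMem U' hrc]
          rcases h1 with h1 | h1
          · exact Or.inl ⟨c₂, h1, rfl⟩
          · exact Or.inr (hIc _ h1)
        · -- q = U' \ c₂ = U \ insert r c₂ ∈ co C ∪ co J = co C ∪ J
          rw [← hcq, ← insertGround_sdiff_insert hr c₂]
          rcases h2 with h2 | h2
          · exact Or.inr (Or.inl ⟨insert r c₂, h2, rfl⟩)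
          · exact Or.inl (Or.inr (hJc _ h2))
      · obtain ⟨h1, hrq, h2⟩ := mem_twinI.mp hq
        exact ⟨hrq, h2.symm, h1.elim (fun h => Or.inl (Or.inl h)) (fun h => Or.inr (Or.inr h))⟩
    obtain ⟨hrp, hpP, hpH⟩ := hp'
    obtain ⟨hrq, hqN, hqH⟩ := hq'
    refine ⟨?_, fun h => hrp (mem_inter.mp h).1, ?_⟩
    · -- p ∩ q ∈ O
      rcases hpH with hpP' | hpN'
      · rcases hqH with hqP' | hqN'
        · -- both on the P side: p ∩ insert r q
          rw [← inter_insert_of_notMem' q hrp]; exact memP hpP' hqN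
        · exact memP hpP' hqN'
      · rcases hqH with hqP' | hqN'
        · rw [inter_comm]; exact memP hqP' hpN'
        · -- both on the N side: insert r p ∩ q
          rw [← insert_inter_of_notMem' p hrq]; exact memP hpP hqN'
    · -- insert r (p ∩ q) ∈ O
      rw [← insert_inter_insert r p q]; exact memP hpP hqN
  · -- z ∈ I₂
    obtain ⟨h1, hrz, h2⟩ := mem_twinI.mp h
    refine ⟨?_, hrz, ?_⟩
    · -- z ∈ O
      rcases h1 with h1 | h1
      · -- z ∈ C: z = z ∩ insert r z with insert r z ∈ N
        have : z ∩ insert r z = z := by rw [inter_insert_of_notMem' z hrz, inter_self]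
        rw [← this]; exact memP (Or.inl h1) h2.symm
      · exact mem_cl_of_mem (mem_twinOut_of_mem_I h1)
    · -- insert r z ∈ O
      rcases h2 with h2 | ⟨c, hc, hcz⟩
      · exact mem_cl_of_mem (mem_twinOut_of_mem_I h2)
      · -- insert r z = U \ c with c ∈ C; c = c ∩ (U \ z) ∈ P ⊼ N, so U \ c ∈ O
        have hzN : (∃ c ∈ C, U \ c = U \ z) ∨ U \ z ∈ I := by
          rcases h1 with h1 | h1
          · exact Or.inl ⟨z, h1, rfl⟩
          · exact Or.inr (hIc _ h1)
        have hcsub : c ⊆ U \ z := by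
          have : c = U \ insert r z := by rw [← hcz, Finset.sdiff_sdiff_eq_self (hC c hc)]
          rw [this]
          exact sdiff_subset_sdiff (subset_refl _) (subset_insert r z)
        have hcO : c ∈ O := by
          have : c ∩ (U \ z) = c := inter_eq_left.mpr hcsub
          rw [← this]; exact memP (Or.inl hc) hzN
        rw [← hcz]; exact compl_mem_cl hout hcO
  · -- z ∈ J₂
    obtain ⟨h1, hrz, h2⟩ := mem_twinJ.mp h
    refine ⟨?_, hrz, ?_⟩
    · -- z ∈ O
      rcases h1 with h1 | h1
      · exact mem_cl_of_mem (mem_twinOut_of_mem_J h1)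
      · -- z ∈ co C: z = insert r z ∩ z with insert r z ∈ P
        have : insert r z ∩ z = z := by rw [insert_inter_of_notMem' z hrz, inter_self]
        rw [← this]; exact memP h2 (Or.inl h1)
    · -- insert r z ∈ O
      rcases h2 with h2 | h2
      · -- insert r z ∈ C: (U \ z) ∩ (U \ insert r z) = U \ insert r z ∈ P ⊼ N, complement = insert r z
        have hzP : U \ z ∈ C ∨ U \ z ∈ J := by
          rcases h1 with h1 | ⟨c, hc, hcz⟩
          · exact Or.inr (hJc _ h1)
          · rw [← hcz, Finset.sdiff_sdiff_eq_self (hC c hc)]; exact Or.inl hc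
        have hN : (∃ c ∈ C, U \ c = U \ insert r z) ∨ U \ insert r z ∈ I := Or.inl ⟨insert r z, h2, rfl⟩
        have hsub : U \ insert r z ⊆ U \ z := sdiff_subset_sdiff (subset_refl _) (subset_insert r z)
        have hmem : U \ insert r z ∈ O := by
          have : (U \ z) ∩ (U \ insert r z) = U \ insert r z := inter_eq_right.mpr hsub
          rw [← this]; exact memP hzP hN
        have := compl_mem_cl hout hmem
        rwa [Finset.sdiff_sdiff_eq_self (hC _ h2)] at this
      · exact mem_cl_of_mem (mem_twinOut_of_mem_J h2)

end Step

/-! ### The twin lemma and Δ-MS -/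

/-- **Twin lemma** (g66 memo, Theorem 1).  For a family `C` of subsets of `U` and families `I, J` of subsets of `U` closed under
`U \ ·`: the closure of `(C ∪ J) ⊼ (co C ∪ I) ∪ I ∪ J` has at least as many members as `C ∪ co C ∪ I ∪ J`.  Proof: induction on `U`
via the projection identity; the projected families give the first summand, the derived configuration `(C₂, I₂, J₂)` the second. -/
theorem card_twinIn_le_card_cl_twinOut (U : Finset α) :
    ∀ (C I J : Finset (Finset α)),
      (∀ c ∈ C, c ⊆ U) → (∀ i ∈ I, i ⊆ U) → (∀ j ∈ J, j ⊆ U) →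
      (∀ i ∈ I, U \ i ∈ I) → (∀ j ∈ J, U \ j ∈ J) →
      #(((C ∪ Finset.image (fun c => U \ c) C) ∪ (I ∪ J))) ≤ #(((((C ∪ J) ⊼ (Finset.image (fun c => U \ c) C ∪ I)) ∪ (I ∪ J)) ∪ Finset.image (fun z => U \ z) (((C
            ∪ J) ⊼ (Finset.image (fun c => U \ c) C ∪ I)) ∪ (I ∪ J)))) := by
  induction U using Finset.induction_on with
  | empty =>
    intro C I J hC hI hJ _ _
    -- every member is ∅; the input is ⊆ {∅} and, if nonempty, ∅ is an output
    by_cases hne : (((C ∪ Finset.image (fun c => ∅ \ c) C) ∪ (I ∪ J))).Nonempty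
    · obtain ⟨s, hs⟩ := hne
      have hsub : ((C ∪ Finset.image (fun c => ∅ \ c) C) ∪ (I ∪ J)) ⊆ {∅} := by
        intro t ht
        rw [mem_singleton]
        rcases mem_twinIn.mp ht with (h | ⟨c, _, rfl⟩) | (h | h)
        · exact subset_empty.mp (hC t h)
        · exact subset_empty.mp sdiff_subset
        · exact subset_empty.mp (hI t h)
        · exact subset_empty.mp (hJ t h)
      have hout : (((((C ∪ J) ⊼ (Finset.image (fun c => ∅ \ c) C ∪ I)) ∪ (I ∪ J)) ∪ Finset.image (fun z => ∅ \ z) (((C ∪ J) ⊼ (Finset.image (fun c => ∅ \ c) C ∪ I))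
            ∪ (I ∪ J)))).Nonempty := by
        rcases mem_twinIn.mp hs with (h | ⟨c, hc, _⟩) | (h | h)
        · have hs0 : s = ∅ := subset_empty.mp (hC s h)
          subst hs0
          exact ⟨∅ ∩ (∅ \ ∅), mem_cl_of_mem (inter_mem_twinOut (Or.inl h) (Or.inl ⟨∅, h, rfl⟩))⟩
        · have hc0 : c = ∅ := subset_empty.mp (hC c hc)
          subst hc0
          exact ⟨∅ ∩ (∅ \ ∅), mem_cl_of_mem (inter_mem_twinOut (Or.inl hc) (Or.inl ⟨∅, hc, rfl⟩))⟩
        · exact ⟨s, mem_cl_of_mem (mem_twinOut_of_mem_I h)⟩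
        · exact ⟨s, mem_cl_of_mem (mem_twinOut_of_mem_J h)⟩
      calc #(((C ∪ Finset.image (fun c => ∅ \ c) C) ∪ (I ∪ J))) ≤ #({∅} : Finset (Finset α)) := card_le_card hsub
        _ = 1 := card_singleton _
        _ ≤ #(((((C ∪ J) ⊼ (Finset.image (fun c => ∅ \ c) C ∪ I)) ∪ (I ∪ J)) ∪ Finset.image (fun z => ∅ \ z) (((C ∪ J) ⊼ (Finset.image (fun c => ∅ \ c) C ∪ I)) ∪ (I
              ∪ J)))) := Nat.one_le_iff_ne_zero.mpr (card_ne_zero.mpr hout)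
    · rw [not_nonempty_iff_eq_empty.mp hne, card_empty]; exact Nat.zero_le _
  | insert r U' hr ih =>
    intro C I J hC hI hJ hIc hJc
    -- the two projection identities
    have hin := card_eq_card_image_erase_add_card_edgesAt (((C ∪ Finset.image (fun c => (insert r U') \ c) C) ∪ (I ∪ J))) r
    have houtc := card_eq_card_image_erase_add_card_edgesAt (((((C ∪ J) ⊼ (Finset.image (fun c => (insert r U') \ c) C ∪ I)) ∪ (I ∪ J))
          ∪ Finset.image (fun z => (insert r U') \ z) (((C ∪ J) ⊼ (Finset.image (fun c => (insert r U') \ c) C ∪ I)) ∪ (I ∪ J)))) r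
    -- (a) projection part
    have ha : #((((C ∪ Finset.image (fun c => (insert r U') \ c) C) ∪ (I ∪ J))).image fun s => s.erase r) ≤
        #((((((C ∪ J) ⊼ (Finset.image (fun c => (insert r U') \ c) C ∪ I)) ∪ (I ∪ J)) ∪ Finset.image (fun z => (insert r U') \ z) (((C
              ∪ J) ⊼ (Finset.image (fun c => (insert r U') \ c) C ∪ I)) ∪ (I ∪ J)))).image fun s => s.erase r) := by
      have h1 := card_le_card (twinIn_image_subset (C := C) (I := I) (J := J) hr)
      have h2 := ih (C.image fun s => s.erase r) (I.image fun s => s.erase r) (J.image fun s => s.erase r)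
        (image_erase_subset hC) (image_erase_subset hI) (image_erase_subset hJ)
        (image_erase_closed hr hIc) (image_erase_closed hr hJc)
      have h3 := card_le_card (cl_twinOut_image_subset hr hC hI hJ)
      exact h1.trans (h2.trans h3)
    -- (b) twin part
    have hb : #(edgesAt (((C ∪ Finset.image (fun c => (insert r U') \ c) C) ∪ (I ∪ J))) r) ≤
        #(edgesAt (((((C ∪ J) ⊼ (Finset.image (fun c => (insert r U') \ c) C ∪ I)) ∪ (I ∪ J)) ∪ Finset.image (fun z => (insert r U') \ z) (((C
              ∪ J) ⊼ (Finset.image (fun c => (insert r U') \ c) C ∪ I)) ∪ (I ∪ J)))) r) := by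
      have h1 := card_le_card (edgesAt_twinIn_subset hr hC hJ hIc hJc)
      have h2 := ih ((Finset.filter (fun w => r ∉ w ∧ insert r w ∈ C ∪ J) (C ∪ I))) ((Finset.filter (fun w => r ∉ w ∧ insert r w ∈ I
            ∪ Finset.image (fun c => (insert r U') \ c) C) (C ∪ I))) ((Finset.filter (fun w => r ∉ w ∧ insert r w ∈ C ∪ J) (J ∪ Finset.image (fun c => (insert r U') \ c) C)))
        (twinC_subset hC hI) (twinI_subset hC hI) (twinJ_subset hJ)
        (twinI_closed hr hC hIc) (twinJ_closed hr hC hJc)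
      -- ((twinOut … C₂ I₂ J₂) ∪ Finset.image (fun z => U' \ z) (twinOut … C₂ I₂ J₂)) ⊆ edgesAt O r, using that the latter is U'-closed
      have hout : ∀ s ∈ (((C ∪ J) ⊼ (Finset.image (fun c => (insert r U') \ c) C ∪ I)) ∪ (I ∪ J)), s ⊆ insert r U' := twinOut_subset hC hI hJ
      have hOc : ∀ z ∈ ((((C ∪ J) ⊼ (Finset.image (fun c => (insert r U') \ c) C ∪ I)) ∪ (I ∪ J)) ∪ Finset.image (fun z => (insert r U') \ z) (((C
            ∪ J) ⊼ (Finset.image (fun c => (insert r U') \ c) C ∪ I)) ∪ (I ∪ J))),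
          insert r U' \ z ∈ ((((C ∪ J) ⊼ (Finset.image (fun c => (insert r U') \ c) C ∪ I)) ∪ (I ∪ J)) ∪ Finset.image (fun z => (insert r U') \ z) (((C
                ∪ J) ⊼ (Finset.image (fun c => (insert r U') \ c) C ∪ I)) ∪ (I ∪ J))) := fun z hz => compl_mem_cl hout hz
      have h3 : (((((Finset.filter (fun w => r ∉ w ∧ insert r w ∈ C ∪ J) (C ∪ I)) ∪ (Finset.filter (fun w => r ∉ w ∧ insert r w ∈ C ∪ J) (J
            ∪ Finset.image (fun c => (insert r U') \ c) C))) ⊼ (Finset.image (fun c => U' \ c) (Finset.filter (fun w => r ∉ w ∧ insert r w ∈ C ∪ J) (C ∪ I))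
            ∪ (Finset.filter (fun w => r ∉ w ∧ insert r w ∈ I ∪ Finset.image (fun c => (insert r U') \ c) C) (C ∪ I)))) ∪ ((Finset.filter (fun w => r ∉ w ∧ insert r w
            ∈ I ∪ Finset.image (fun c => (insert r U') \ c) C) (C ∪ I)) ∪ (Finset.filter (fun w => r ∉ w ∧ insert r w ∈ C ∪ J) (J
            ∪ Finset.image (fun c => (insert r U') \ c) C)))) ∪ Finset.image (fun z => U' \ z) ((((Finset.filter (fun w => r ∉ w ∧ insert r w ∈ C ∪ J) (C ∪ I))
            ∪ (Finset.filter (fun w => r ∉ w ∧ insert r w ∈ C ∪ J) (J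
            ∪ Finset.image (fun c => (insert r U') \ c) C))) ⊼ (Finset.image (fun c => U' \ c) (Finset.filter (fun w => r ∉ w ∧ insert r w ∈ C ∪ J) (C ∪ I))
            ∪ (Finset.filter (fun w => r ∉ w ∧ insert r w ∈ I ∪ Finset.image (fun c => (insert r U') \ c) C) (C ∪ I)))) ∪ ((Finset.filter (fun w => r ∉ w ∧ insert r w
            ∈ I ∪ Finset.image (fun c => (insert r U') \ c) C) (C ∪ I)) ∪ (Finset.filter (fun w => r ∉ w ∧ insert r w ∈ C ∪ J) (J
            ∪ Finset.image (fun c => (insert r U') \ c) C))))) ⊆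
          edgesAt (((((C ∪ J) ⊼ (Finset.image (fun c => (insert r U') \ c) C ∪ I)) ∪ (I ∪ J)) ∪ Finset.image (fun z => (insert r U') \ z) (((C
                ∪ J) ⊼ (Finset.image (fun c => (insert r U') \ c) C ∪ I)) ∪ (I ∪ J)))) r := by
        intro z hz
        rcases mem_cl.mp hz with h | ⟨o, ho, rfl⟩
        · exact twinOut_twin_subset_edgesAt hr hC hI hJ hIc hJc h
        · exact edgesAt_closed hr hOc _ (twinOut_twin_subset_edgesAt hr hC hI hJ hIc hJc ho)
      exact h1.trans (h2.trans (card_le_card h3))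
    omega

/-- **Δ-MS (projective Marica–Schönheim; g66 memo, Theorem 2).**  For every family `F` of subsets of `U`, the family of differences
`F \\ F` meets at least as many complementary pairs `{s, U \ s}` as `F` does: `#(F ∪ co F) ≤ #(F \\ F ∪ co (F \\ F))`.  (The twin lemma
with `I = J = ∅`: `F ⊼ co F = F \\ F`.)  For `F` with no two complementary members the left side is `2 · #F`
(`two_mul_card_le_card_cl_diffs`). -/
theorem card_cl_le_card_cl_diffs (U : Finset α) (F : Finset (Finset α)) (hF : ∀ f ∈ F, f ⊆ U) :
    #((F ∪ Finset.image (fun z => U \ z) F)) ≤ #(((F \\ F) ∪ Finset.image (fun z => U \ z) (F \\ F))) := by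
  have h := card_twinIn_le_card_cl_twinOut U F ∅ ∅ hF (by simp) (by simp) (by simp) (by simp)
  have hin : ((F ∪ Finset.image (fun c => U \ c) F) ∪ (∅ ∪ ∅)) = (F ∪ Finset.image (fun z => U \ z) F) := by
    rw [union_empty, union_empty]
  have hout : (((F ∪ ∅) ⊼ (Finset.image (fun c => U \ c) F ∪ ∅)) ∪ (∅ ∪ ∅)) = F \\ F := by
    simp only [union_empty]
    ext s
    rw [mem_infs, mem_diffs]
    constructor
    · rintro ⟨a, ha, b, hb, rfl⟩
      obtain ⟨c, hc, rfl⟩ := mem_image.mp hb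
      refine ⟨a, ha, c, hc, ?_⟩
      have h1 := sdiff_univ_compl_eq_inter (U := U) (f := U \ c) (hF a ha)
      rw [Finset.sdiff_sdiff_eq_self (hF c hc)] at h1
      exact h1
    · rintro ⟨a, ha, c, hc, rfl⟩
      refine ⟨a, ha, U \ c, mem_image_of_mem _ hc, ?_⟩
      have h1 := sdiff_univ_compl_eq_inter (U := U) (f := U \ c) (hF a ha)
      rw [Finset.sdiff_sdiff_eq_self (hF c hc)] at h1
      exact h1.symm
  rw [hin, hout] at h
  exact h

/-- **Δ-MS for complement-free families**: if no two members of `F ⊆ 𝒫 U` are complementary in `U`, then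
`2 · #F ≤ #(F \\ F ∪ co (F \\ F))`; in particular (`Finset.card_le_card_diffs` is the weaker `#F ≤ #(F \\ F)`). -/
theorem two_mul_card_le_card_cl_diffs (U : Finset α) (F : Finset (Finset α)) (hF : ∀ f ∈ F, f ⊆ U)
    (hfree : ∀ f ∈ F, U \ f ∉ F) :
    2 * #F ≤ #(((F \\ F) ∪ Finset.image (fun z => U \ z) (F \\ F))) := by
  have h := card_cl_le_card_cl_diffs U F hF
  have hdisj : Disjoint F (F.image fun f => U \ f) := by
    rw [disjoint_left]
    intro s hs hs'
    obtain ⟨f, hf, rfl⟩ := mem_image.mp hs'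
    exact hfree f hf hs
  have hinj : Set.InjOn (fun f : Finset α => U \ f) (F : Set (Finset α)) := by
    intro a ha b hb hab
    have := congrArg (fun s => U \ s) hab
    simp only [Finset.sdiff_sdiff_eq_self (hF a (mem_coe.mp ha)), Finset.sdiff_sdiff_eq_self (hF b (mem_coe.mp hb))] at this
    exact this
  have hcl : #((F ∪ Finset.image (fun z => U \ z) F)) = 2 * #F := by
    rw [card_union_of_disjoint hdisj, card_image_of_injOn hinj]; ring
  rw [hcl] at h; exact h

end DeltaMS

end GeneratedDonors

end Summit.CriticalPhenomena.PercolationContinuityZ3.Theorems
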